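import Summits.RiemannHypothesis.RiemannHypothesis.Theorems.SignConeConeMagnificationCombTypeFamilySums
import Summits.RiemannHypothesis.RiemannHypothesis.Theorems.SignConeConeMagnificationCombTypeNodeLemmas
import Summits.RiemannHypothesis.RiemannHypothesis.Theorems.SignConeConeMagnificationCombTypeNodeParams

/-!
# Crux `SignCone.ConeMagnification` (stmt-RiemannHypothesis-16303), line `Sketch` r9, stub `stub_combType` — sharp node evaluation VII:
# the SHARP node weight of a main-range node (raw form)

Backstop, part 7.  For a node `n` of the pair `(ℓ, ℓ')` in the main range `8hL²n ≤ 1` (window `0 < h ≤ 1/(32L)`, `hM ≥ 1`,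
`κ = hM ≥ 2L`), with `K₀' = ⌊1/(4hnℓ')⌋`, `K₁ = min M ⌊ℓMe^{−2h}/(ℓ'n)⌋`, `g = gcd(nℓ',ℓ)`, `P = ℓ/g`, `V = K₁nℓ'h/g`,
`ρ = √ℓ/√ℓ'`, `ρ' = √ℓ'/√ℓ`, `β = β_h`, and the CLASS TERM

  `S = ρ (g/ℓ) (B(0) log(2g) + I_H − ∫B/2) + β ρ'/(4ℓ')`,  `I_H = ∫_{1/2}^∞ H`,

the node weight satisfies (`CombType.node_sharp_main_raw`)

  `|V(n) − B(0) ρ D(n)/n − hβρ'(K₁ − K₀') − S/n| ≤ ε_A + ε_E + B(0)ρ/(nP)·(2P/K₁ + 2P/K₀' + 8nℓ'h) + ρ/(nP)·5N₂/(2V) + 8N₀h²ρ'K₁ + βρ'h`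

with `ε_A` the error of `CombType.family_block_eval` and `ε_E = hβL(8hLM/n + 1) + C₂/(hn²K₁)` the edge block of `node_block_edge`;
the main terms cancel EXACTLY (`ρV/(nP) = hρ'K₁`), and `H(⌊K₁/P⌋) − H(⌊K₀'/P⌋) − log(2V) − log(2g) = −log(4K₀'nℓ'h) + O(P/K₁ + P/K₀')`
by the Euler–Mascheroni asymptotics.  The simplification to `e₀ + e₁/n` and the corner nodes follow in `…CombTypeNodeSharp`.
-/

noncomputable section

-- `Summit.RiemannHypothesis.RiemannHypothesis.…` repeats a namespace component by design (D-0017 layout).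
set_option linter.dupNamespace false

open scoped BigOperators
open MeasureTheory Set

namespace Summit.RiemannHypothesis.RiemannHypothesis.Theorems.SignConeConeMagnification

open Literature.NumberTheory.LFunctions

namespace CombType

/-- The bookkeeping of `node_sharp_main_raw`: the exact cancellation of the main terms. [folklore] -/
theorem node_main_combine
    {Vn A E M0 FAM εA εE deep smooth Sn B0 ρ ρ' nr P Ha Hb IH TL iB V lg h β K₁r K₀r ℓ'r t3 t4 t5 t6 : ℝ}
    (hV : Vn = A + E) (hA : |A - M0 - FAM| ≤ εA) (hE0 : 0 ≤ E) (hE : E ≤ εE)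
    (hM0 : M0 = B0 * ρ / nr * (1 / P) * Ha)
    (hFAM : FAM = ρ / nr * (1 / P) * (IH - TL + iB * (V - 1 / 2) - B0 * Real.log (2 * V)))
    (hdeep : deep = B0 * ρ * ((1 / P) * Hb) / nr) (hsmooth : smooth = h * β * ρ' * (K₁r - K₀r))
    (hS : Sn = (ρ * (1 / P) * (B0 * lg + IH - iB / 2) + β * ρ' / (4 * ℓ'r)) / nr)
    (hρV : ρ / nr * (1 / P) * V = h * ρ' * K₁r)
    (h3 : |B0 * ρ / nr * (1 / P) * (Ha - Hb - Real.log (2 * V) - lg)| ≤ t3)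
    (h4 : |ρ / nr * (1 / P) * TL| ≤ t4) (h5 : |h * (iB - β) * ρ' * K₁r| ≤ t5)
    (h6 : |β * ρ' * (h * K₀r - 1 / (4 * ℓ'r * nr))| ≤ t6) :
    |Vn - deep - smooth - Sn| ≤ εA + εE + t3 + t4 + t5 + t6 := by
  have key : Vn - deep - smooth - Sn = (A - M0 - FAM) + E
      + B0 * ρ / nr * (1 / P) * (Ha - Hb - Real.log (2 * V) - lg) - ρ / nr * (1 / P) * TL
      + h * (iB - β) * ρ' * K₁r + β * ρ' * (h * K₀r - 1 / (4 * ℓ'r * nr)) := by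
    rw [hV, hM0, hFAM, hdeep, hsmooth, hS]
    have e1 : ρ / nr * (1 / P) * (iB * V) = iB * (h * ρ' * K₁r) := by rw [← hρV]; ring
    have e2 : β * ρ' / (4 * ℓ'r) / nr = β * ρ' * (1 / (4 * ℓ'r * nr)) := by ring
    linear_combination e1
  rw [key]
  have a1 := abs_add_le ((A - M0 - FAM) + E + B0 * ρ / nr * (1 / P) * (Ha - Hb - Real.log (2 * V) - lg) - ρ / nr * (1 / P) * TL
      + h * (iB - β) * ρ' * K₁r) (β * ρ' * (h * K₀r - 1 / (4 * ℓ'r * nr)))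
  have a2 := abs_add_le ((A - M0 - FAM) + E + B0 * ρ / nr * (1 / P) * (Ha - Hb - Real.log (2 * V) - lg) - ρ / nr * (1 / P) * TL)
      (h * (iB - β) * ρ' * K₁r)
  have a3 := abs_sub ((A - M0 - FAM) + E + B0 * ρ / nr * (1 / P) * (Ha - Hb - Real.log (2 * V) - lg)) (ρ / nr * (1 / P) * TL)
  have a4 := abs_add_le ((A - M0 - FAM) + E) (B0 * ρ / nr * (1 / P) * (Ha - Hb - Real.log (2 * V) - lg))
  have a5 := abs_add_le (A - M0 - FAM) E
  have hEa : |E| = E := abs_of_nonneg hE0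
  linarith

set_option maxHeartbeats 1600000 in
/-- **The sharp node weight of a main-range node (raw form).**  See the module docstring. [folklore] -/
theorem node_sharp_main_raw {B B' B'' : ℝ → ℝ} {N₀ N₁ N₂ h : ℝ} {L ℓ ℓ' M n : ℕ}
    (hB : ∀ x, HasDerivAt B (B' x) x) (hB' : ∀ x, HasDerivAt B' (B'' x) x)
    (h0 : ∀ x, |B x| ≤ N₀) (h1 : ∀ x, |B' x| ≤ N₁) (h2 : ∀ x, |B'' x| ≤ N₂)
    (hBs : ∀ x, 2 < |x| → B x = 0) (hB0 : ∀ x, 0 ≤ B x)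
    (hL : 1 ≤ L) (hℓ : 1 ≤ ℓ) (hℓL : ℓ ≤ L) (hℓ' : 1 ≤ ℓ') (hℓ'L : ℓ' ≤ L) (hn : 1 ≤ n)
    (hh : 0 < h) (hhL : h ≤ 1 / (32 * L)) (hhM : 1 ≤ h * M) (hκL : 2 * (L : ℝ) ≤ h * M) (hnY : 8 * h * L ^ 2 * n ≤ 1) :
    |(∑ k' ∈ Finset.Icc 1 M,
        (∑ k ∈ Finset.Icc 1 M, B ((Real.log ((n : ℝ) * ℓ' * k' / ℓ) - Real.log k) / h) / Real.sqrt k)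
          / Real.sqrt k' / Real.sqrt n)
      - B 0 * (Real.sqrt ℓ / Real.sqrt ℓ') *
          (∑ k' ∈ Finset.Icc 1 ⌊1 / (4 * h) / ((n : ℝ) * ℓ')⌋₊,
            (if ℓ ∣ n * ℓ' * k' then 1 / (k' : ℝ) else 0)) / n
      - h * (∫ v, B v * Real.exp (-(h * v) / 2)) * (Real.sqrt ℓ' / Real.sqrt ℓ) *
          ((min M ⌊(ℓ : ℝ) * M * Real.exp (-(2 * h)) / (ℓ' * n)⌋₊
              - ⌊1 / (4 * h) / ((n : ℝ) * ℓ')⌋₊ : ℕ) : ℝ)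
      - ((Real.sqrt ℓ / Real.sqrt ℓ') * ((Nat.gcd (n * ℓ') ℓ : ℝ) / ℓ) *
            (B 0 * Real.log (2 * (Nat.gcd (n * ℓ') ℓ : ℝ))
              + (∫ v in Ioi (1 / 2 : ℝ), ((∑' m : ℤ, B (m / v)) - v * ∫ x, B x) / v) - (∫ x, B x) / 2)
          + (∫ v, B v * Real.exp (-(h * v) / 2)) * (Real.sqrt ℓ' / Real.sqrt ℓ) / (4 * ℓ')) / n|
      ≤ ((192 * N₁ + 12 * N₀) * h * (Real.sqrt ℓ / Real.sqrt ℓ') *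
            (16 * h * ℓ' * (min M ⌊(ℓ : ℝ) * M * Real.exp (-(2 * h)) / (ℓ' * n)⌋₊ : ℕ) / Nat.gcd (n * ℓ') ℓ
              + (∑ j ∈ Finset.Icc 1 (min M ⌊(ℓ : ℝ) * M * Real.exp (-(2 * h)) / (ℓ' * n)⌋₊), (1 : ℝ) / j) / n)
          + (16 * N₁ + 14 * N₀) * (Real.sqrt ℓ / Real.sqrt ℓ') * (ℓ' * h / Nat.gcd (n * ℓ') ℓ) *
            (2 * (1 + Real.log (⌈8 * (h * M) * L⌉₊ + 1))))
        + (h * (∫ v, B v * Real.exp (-(h * v) / 2)) * L * (8 * h * L * M / n + 1)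
            + (N₀ + 2 * N₁ + N₂) * (96 + 192 * L) * L ^ 2 / (h * (n : ℝ) ^ 2)
              * ((min M ⌊(ℓ : ℝ) * M * Real.exp (-(2 * h)) / (ℓ' * n)⌋₊ : ℕ) : ℝ)⁻¹)
        + B 0 * (Real.sqrt ℓ / Real.sqrt ℓ') / n *
            (2 / (min M ⌊(ℓ : ℝ) * M * Real.exp (-(2 * h)) / (ℓ' * n)⌋₊ : ℕ)
              + 2 / ⌊1 / (4 * h) / ((n : ℝ) * ℓ')⌋₊ + 8 * n * ℓ' * h / ((ℓ / Nat.gcd (n * ℓ') ℓ : ℕ) : ℝ))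
        + (Real.sqrt ℓ / Real.sqrt ℓ') / n * (1 / ((ℓ / Nat.gcd (n * ℓ') ℓ : ℕ) : ℝ)) *
            (5 * N₂ / (2 * ((min M ⌊(ℓ : ℝ) * M * Real.exp (-(2 * h)) / (ℓ' * n)⌋₊ : ℕ) * n * ℓ' * h / Nat.gcd (n * ℓ') ℓ)))
        + h * (8 * N₀ * h) * (Real.sqrt ℓ' / Real.sqrt ℓ) * (min M ⌊(ℓ : ℝ) * M * Real.exp (-(2 * h)) / (ℓ' * n)⌋₊ : ℕ)
        + (∫ v, B v * Real.exp (-(h * v) / 2)) * (Real.sqrt ℓ' / Real.sqrt ℓ) * h := by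
  have hN₀ : 0 ≤ N₀ := (abs_nonneg _).trans (h0 0)
  have hN₁ : 0 ≤ N₁ := (abs_nonneg _).trans (h1 0)
  have hN₂ : 0 ≤ N₂ := (abs_nonneg _).trans (h2 0)
  have hBc : Continuous B := continuous_iff_continuousAt.2 fun x => (hB x).continuousAt
  have hLR : (1 : ℝ) ≤ L := by exact_mod_cast hL
  have hnR : (1 : ℝ) ≤ n := by exact_mod_cast hn
  have hn0 : (0 : ℝ) < n := by linarith
  have hℓ0 : (0 : ℝ) < ℓ := by exact_mod_cast hℓ
  have hℓ'0 : (0 : ℝ) < ℓ' := by exact_mod_cast hℓ'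
  have h32 : 1 / (32 * (L : ℝ)) ≤ 1 / 32 := one_div_le_one_div_of_le (by norm_num) (by linarith)
  have hh4 : h < 1 / 4 := by linarith
  have hh16 : h ≤ 1 / 16 := by linarith
  have hh1 : h ≤ 1 := by linarith
  obtain ⟨hK₀K₁, hK₁M, -, -⟩ := node_ranges (M := M) hℓ hℓ' hn hh hh4.le hhM
  obtain ⟨hP1, hPL, hg1, hgℓ, hga, hPg⟩ := quot_gcd_bounds (L := L) hn hℓ hℓL hℓ'
  obtain ⟨hPK₀, hK₀low, hhK₀up, hhK₀low, h4nh⟩ := node_main_deep hL hn hℓ hℓL hℓ' hℓ'L hh hnY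
  obtain ⟨hPK₁, -, hK₁le, hfull, hM4, hVlow, hVup⟩ := node_main_teeth (M := M) hL hn hℓ hℓL hℓ' hℓ'L hh hhL hhM hκL hnY
  -- names
  set K₀ : ℕ := ⌊1 / (4 * h) / ((n : ℝ) * ℓ')⌋₊ with hK₀
  set K₁ : ℕ := min M ⌊(ℓ : ℝ) * M * Real.exp (-(2 * h)) / (ℓ' * n)⌋₊ with hK₁
  set g : ℝ := (Nat.gcd (n * ℓ') ℓ : ℝ) with hgdef
  set P : ℝ := ((ℓ / Nat.gcd (n * ℓ') ℓ : ℕ) : ℝ) with hPdef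
  set ρ : ℝ := Real.sqrt ℓ / Real.sqrt ℓ' with hρ
  set ρ' : ℝ := Real.sqrt ℓ' / Real.sqrt ℓ with hρ'
  set β : ℝ := ∫ v, B v * Real.exp (-(h * v) / 2) with hβ
  set iB : ℝ := ∫ x, B x with hiB
  set IH : ℝ := ∫ v in Ioi (1 / 2 : ℝ), ((∑' m : ℤ, B (m / v)) - v * ∫ x, B x) / v with hIH
  set V : ℝ := (K₁ : ℝ) * n * ℓ' * h / g with hVdef
  set TL : ℝ := ∫ v in Ioi V, ((∑' m : ℤ, B (m / v)) - v * ∫ x, B x) / v with hTL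
  set T : ℕ → ℝ := fun k' =>
    (∑ k ∈ Finset.Icc 1 M, B ((Real.log ((n : ℝ) * ℓ' * k' / ℓ) - Real.log k) / h) / Real.sqrt k)
      / Real.sqrt k' / Real.sqrt n with hT
  have hκ2 : (2 : ℝ) ≤ h * M := le_trans (by linarith) hκL
  have hg0 : 0 < g := by rw [hgdef]; linarith
  have hP0 : 0 < P := by rw [hPdef]; linarith
  have hρ0 : 0 ≤ ρ := by positivity
  have hρ'0 : 0 ≤ ρ' := by positivity
  have hβ0 : 0 ≤ β := toothBeta_nonneg hB0 h
  have hβ8 : β ≤ 8 * N₀ := toothBeta_le hB0 h0 hBs hh.le hh4.le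
  have hK₁pos : (0 : ℝ) < K₁ := lt_of_lt_of_le hP0 hPK₁
  have hK₁ne : K₁ ≠ 0 := by
    intro h0'; rw [h0', Nat.cast_zero] at hK₁pos; exact lt_irrefl _ hK₁pos
  have hK₀pos : (0 : ℝ) < K₀ := lt_of_lt_of_le hP0 hPK₀
  have hV0 : 0 < V := by
    have : 0 < h * M / (4 * L) := by positivity
    exact lt_of_lt_of_le this hVlow
  have hVhalf : 1 / 2 ≤ V := by
    have : 1 / 2 ≤ h * M / (4 * L) := by
      rw [le_div_iff₀ (by positivity)]; linarith
    exact this.trans hVlow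
  -- (1) the block split `Icc 1 M = Icc 1 K₁ ∪ Ioc K₁ M`
  have hIcc : ∀ N : ℕ, Finset.Icc 1 N = Finset.Ioc 0 N := fun N => by
    ext k; simp only [Finset.mem_Icc, Finset.mem_Ioc]; omega
  have hsplit : ∑ k' ∈ Finset.Icc 1 M, T k' = ∑ k' ∈ Finset.Icc 1 K₁, T k' + ∑ k' ∈ Finset.Ioc K₁ M, T k' := by
    rw [hIcc, hIcc, ← Finset.sum_Ioc_consecutive _ (Nat.zero_le K₁) hK₁M]
  -- (2) the full-teeth block through the families
  set M₀ : ℕ := ⌈8 * (h * M) * L⌉₊ with hM₀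
  have hM₀ge : 8 * (h * M) * L ≤ M₀ := Nat.le_ceil _
  have hM₀hyp : 8 * h * n * ℓ' * K₁ ≤ Nat.gcd (n * ℓ') ℓ * M₀ := by
    -- `8 h n ℓ' K₁ = 8 g V ≤ 8 g κ L ≤ g M₀`
    have e : 8 * h * n * ℓ' * (K₁ : ℝ) = g * (8 * V) := by rw [hVdef]; field_simp
    rw [e, ← hgdef]
    refine mul_le_mul_of_nonneg_left ?_ hg0.le
    calc 8 * V ≤ 8 * (h * M * L) := by linarith
      _ = 8 * (h * M) * L := by ring
      _ ≤ M₀ := hM₀ge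
  have hVM : 2 * ((K₁ : ℝ) * n * ℓ' * h / Nat.gcd (n * ℓ') ℓ) < M₀ + 1 := by
    rw [← hgdef, ← hVdef]
    have hML : 0 ≤ h * M * L := by positivity
    linarith [hM₀ge, hML, hVup]
  have hVhalf' : 1 / 2 ≤ (K₁ : ℝ) * n * ℓ' * h / Nat.gcd (n * ℓ') ℓ := by rw [← hgdef]; exact hVhalf
  have hA := family_block_eval (M := M) (M₀ := M₀) hB hB' h0 h1 h2 hBs hh hh16 hn hℓ hℓ' hfull hM₀hyp hVhalf' hVM
  -- (3) the edge block
  obtain ⟨hEpos, hEle⟩ := node_block_edge (M := M) hB hB' h0 h1 h2 hBs hB0 hL hℓ hℓL hℓ' hℓ'L hn hh hhL hhM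
  have hEerr : ∑ k' ∈ Finset.Ioc K₁ M, (N₀ + 2 * N₁ + N₂) * (96 + 192 * L) * L ^ 2 / (h * ((n : ℝ) * k') ^ 2)
      ≤ (N₀ + 2 * N₁ + N₂) * (96 + 192 * L) * L ^ 2 / (h * (n : ℝ) ^ 2) * (K₁ : ℝ)⁻¹ := by
    have heq : ∑ k' ∈ Finset.Ioc K₁ M, (N₀ + 2 * N₁ + N₂) * (96 + 192 * L) * L ^ 2 / (h * ((n : ℝ) * k') ^ 2)
        = (N₀ + 2 * N₁ + N₂) * (96 + 192 * L) * L ^ 2 / (h * (n : ℝ) ^ 2) * ∑ k' ∈ Finset.Ioc K₁ M, ((k' : ℝ) ^ 2)⁻¹ := by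
      rw [Finset.mul_sum]
      refine Finset.sum_congr rfl fun k' hk' => ?_
      have hk'0 : (0 : ℝ) < k' := by
        have : 1 ≤ k' := by have := (Finset.mem_Ioc.1 hk').1; omega
        exact_mod_cast this
      field_simp
    rw [heq]
    refine mul_le_mul_of_nonneg_left ?_ (by positivity)
    have := sum_Ioc_inv_sq_le_sub (α := ℝ) hK₁ne hK₁M
    have hM0' : (0 : ℝ) ≤ (M : ℝ)⁻¹ := by positivity
    linarith
  -- (4) the deep term `D(n) = (1/P) H(K₀/P)`
  have hdeep : B 0 * ρ * (∑ k' ∈ Finset.Icc 1 K₀, (if ℓ ∣ n * ℓ' * k' then 1 / (k' : ℝ) else 0)) / n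
      = B 0 * ρ * ((1 / P) * ∑ j ∈ Finset.Icc 1 (K₀ / (ℓ / Nat.gcd (n * ℓ') ℓ)), (1 : ℝ) / j) / n := by
    rw [sum_dvd_indicator_div_eq ℓ n ℓ' K₀ (by omega), sum_one_div_mul_eq]
  -- (5) the smooth term as a real difference
  have hsmooth : h * β * ρ' * ((K₁ - K₀ : ℕ) : ℝ) = h * β * ρ' * ((K₁ : ℝ) - K₀) := by
    rw [Nat.cast_sub hK₀K₁]
  -- (6) the exact cancellation `ρ V/(n P) = h ρ' K₁`
  have hρV : ρ / n * (1 / P) * V = h * ρ' * K₁ := by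
    have hsℓ : 0 < Real.sqrt (ℓ : ℝ) := Real.sqrt_pos.2 hℓ0
    have hsℓ' : 0 < Real.sqrt (ℓ' : ℝ) := Real.sqrt_pos.2 hℓ'0
    have hs1 : Real.sqrt (ℓ : ℝ) * Real.sqrt ℓ = ℓ := Real.mul_self_sqrt hℓ0.le
    have hs2 : Real.sqrt (ℓ' : ℝ) * Real.sqrt ℓ' = ℓ' := Real.mul_self_sqrt hℓ'0.le
    have key : ρ * ℓ' = ρ' * ℓ := by
      rw [hρ, hρ', div_mul_eq_mul_div, div_mul_eq_mul_div, div_eq_div_iff hsℓ'.ne' hsℓ.ne']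
      calc Real.sqrt ℓ * ℓ' * Real.sqrt ℓ = (Real.sqrt (ℓ : ℝ) * Real.sqrt ℓ) * ℓ' := by ring
        _ = ℓ * ℓ' := by rw [hs1]
        _ = (Real.sqrt (ℓ' : ℝ) * Real.sqrt ℓ') * ℓ := by rw [hs2]; ring
        _ = Real.sqrt ℓ' * ℓ * Real.sqrt ℓ' := by ring
    have e1 : ρ / n * (1 / P) * V = ρ * ℓ' * ((K₁ : ℝ) * h) / (P * g) := by rw [hVdef]; field_simp
    have e2 : h * ρ' * K₁ = ρ' * ℓ * ((K₁ : ℝ) * h) / ℓ := by field_simp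
    rw [e1, e2, hPg, key]
  -- (7) the four small terms
  -- (7a) harmonic asymptotics
  have h3 : |B 0 * ρ / n * (1 / P) * ((∑ j ∈ Finset.Icc 1 (K₁ / (ℓ / Nat.gcd (n * ℓ') ℓ)), (1 : ℝ) / j)
        - (∑ j ∈ Finset.Icc 1 (K₀ / (ℓ / Nat.gcd (n * ℓ') ℓ)), (1 : ℝ) / j)
        - Real.log (2 * V) - Real.log (2 * g))|
      ≤ B 0 * ρ / n * (2 / (K₁ : ℝ) + 2 / (K₀ : ℝ) + 8 * n * ℓ' * h / P) := by
    have hB00 : 0 ≤ B 0 := hB0 0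
    rw [abs_mul, abs_of_nonneg (by positivity : 0 ≤ B 0 * ρ / n * (1 / P))]
    have hcoef : B 0 * ρ / n * (1 / P) * (P * (2 / (K₁ : ℝ) + 2 / (K₀ : ℝ) + 8 * n * ℓ' * h / P))
        = B 0 * ρ / n * (2 / (K₁ : ℝ) + 2 / (K₀ : ℝ) + 8 * n * ℓ' * h / P) := by field_simp
    rw [← hcoef]
    refine mul_le_mul_of_nonneg_left ?_ (by positivity)
    -- the two floors are `⌊K/P⌋` of reals `≥ 1`
    have hfa : K₁ / (ℓ / Nat.gcd (n * ℓ') ℓ) = ⌊(K₁ : ℝ) / P⌋₊ := by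
      rw [hPdef, Nat.floor_div_natCast, Nat.floor_natCast]
    have hfb : K₀ / (ℓ / Nat.gcd (n * ℓ') ℓ) = ⌊(K₀ : ℝ) / P⌋₊ := by
      rw [hPdef, Nat.floor_div_natCast, Nat.floor_natCast]
    have hxa : 1 ≤ (K₁ : ℝ) / P := by rw [le_div_iff₀ hP0]; linarith
    have hxb : 1 ≤ (K₀ : ℝ) / P := by rw [le_div_iff₀ hP0]; linarith
    have ha := abs_harmonic_floor_sub_log_sub_euler_le hxa
    have hb := abs_harmonic_floor_sub_log_sub_euler_le hxb
    rw [← hfa] at ha; rw [← hfb] at hb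
    -- the logarithms: `log(K₁/P) − log(K₀/P) − log(2V) − log(2g) = −log(4 K₀ n ℓ' h)`
    have hlogid : Real.log ((K₁ : ℝ) / P) - Real.log ((K₀ : ℝ) / P) - Real.log (2 * V) - Real.log (2 * g)
        = -Real.log (4 * K₀ * n * ℓ' * h) := by
      have e1 : (K₁ : ℝ) / P / ((K₀ : ℝ) / P) / (2 * V) / (2 * g) = (4 * K₀ * n * ℓ' * h)⁻¹ := by
        rw [hVdef]; field_simp; ring
      rw [← Real.log_div (by positivity) (by positivity), ← Real.log_div (by positivity) (by positivity),
        ← Real.log_div (by positivity) (by positivity), e1, Real.log_inv]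
    have hu : |Real.log (4 * K₀ * n * ℓ' * h)| ≤ 2 * (4 * n * ℓ' * h) := by
      refine abs_log_le_of_one_sub_le h4nh ?_ ?_
      · have := hhK₀low
        have e : 4 * (K₀ : ℝ) * n * ℓ' * h = 4 * n * ℓ' * (h * K₀) := by ring
        rw [e]
        have : 4 * (n : ℝ) * ℓ' * (1 / (4 * n * ℓ') - h) ≤ 4 * n * ℓ' * (h * K₀) :=
          mul_le_mul_of_nonneg_left hhK₀low (by positivity)
        have e2 : 4 * (n : ℝ) * ℓ' * (1 / (4 * n * ℓ') - h) = 1 - 4 * n * ℓ' * h := by field_simp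
        linarith
      · have e : 4 * (K₀ : ℝ) * n * ℓ' * h = 4 * n * ℓ' * (h * K₀) := by ring
        rw [e]
        have : 4 * (n : ℝ) * ℓ' * (h * K₀) ≤ 4 * n * ℓ' * (1 / (4 * n * ℓ')) :=
          mul_le_mul_of_nonneg_left hhK₀up (by positivity)
        have e2 : 4 * (n : ℝ) * ℓ' * (1 / (4 * n * ℓ')) = 1 := by field_simp
        linarith
    -- combine
    have e3 : P * (2 / (K₁ : ℝ) + 2 / (K₀ : ℝ) + 8 * n * ℓ' * h / P) = 2 / ((K₁ : ℝ) / P) + 2 / ((K₀ : ℝ) / P) + 8 * n * ℓ' * h := by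
      field_simp
    rw [e3]
    have htri : ∀ (x y lx ly γ c d : ℝ), |x - lx - γ| ≤ c → |y - ly - γ| ≤ d →
        |x - y - (lx - ly)| ≤ c + d := by
      intro x y lx ly γ c d hx hy
      have := abs_sub (x - lx - γ) (y - ly - γ)
      have e : x - lx - γ - (y - ly - γ) = x - y - (lx - ly) := by ring
      rw [e] at this; linarith
    have hmain := htri _ _ _ _ _ _ _ ha hb
    have e4 : (∑ j ∈ Finset.Icc 1 (K₁ / (ℓ / Nat.gcd (n * ℓ') ℓ)), (1 : ℝ) / j)
        - (∑ j ∈ Finset.Icc 1 (K₀ / (ℓ / Nat.gcd (n * ℓ') ℓ)), (1 : ℝ) / j) - Real.log (2 * V) - Real.log (2 * g)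
        = ((∑ j ∈ Finset.Icc 1 (K₁ / (ℓ / Nat.gcd (n * ℓ') ℓ)), (1 : ℝ) / j)
            - (∑ j ∈ Finset.Icc 1 (K₀ / (ℓ / Nat.gcd (n * ℓ') ℓ)), (1 : ℝ) / j)
            - (Real.log ((K₁ : ℝ) / P) - Real.log ((K₀ : ℝ) / P)))
          + (Real.log ((K₁ : ℝ) / P) - Real.log ((K₀ : ℝ) / P) - Real.log (2 * V) - Real.log (2 * g)) := by ring
    rw [e4, hlogid]
    refine (abs_add_le _ _).trans ?_
    rw [abs_neg]
    linarith
  -- (7b) the tail of the `H`-integral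
  have h4 : |ρ / n * (1 / P) * TL| ≤ ρ / n * (1 / P) * (5 * N₂ / (2 * V)) := by
    rw [abs_mul, abs_of_nonneg (by positivity : 0 ≤ ρ / n * (1 / P))]
    exact mul_le_mul_of_nonneg_left (abs_integral_periodizationH_Ioi_le hB hB' h2 hBs hVhalf) (by positivity)
  -- (7c) `β` against `∫B`
  have h5 : |h * (iB - β) * ρ' * K₁| ≤ h * (8 * N₀ * h) * ρ' * K₁ := by
    have hb := abs_toothBeta_sub_integral_le (N₀ := N₀) (h := h) hBc h0 hBs hh.le hh1
    rw [abs_sub_comm] at hb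
    rw [abs_mul, abs_mul, abs_mul, abs_of_pos hh, abs_of_nonneg hρ'0, abs_of_nonneg hK₁pos.le]
    refine mul_le_mul_of_nonneg_right (mul_le_mul_of_nonneg_right (mul_le_mul_of_nonneg_left hb hh.le) hρ'0) hK₁pos.le
  -- (7d) the floor in `K₀`
  have h6 : |β * ρ' * (h * K₀ - 1 / (4 * ℓ' * n))| ≤ β * ρ' * h := by
    rw [abs_mul, abs_of_nonneg (mul_nonneg hβ0 hρ'0)]
    refine mul_le_mul_of_nonneg_left ?_ (mul_nonneg hβ0 hρ'0)
    have e : 1 / (4 * (ℓ' : ℝ) * n) = 1 / (4 * n * ℓ') := by ring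
    rw [e, abs_le]; constructor <;> linarith
  -- (8) combine
  have hmain := node_main_combine (Vn := ∑ k' ∈ Finset.Icc 1 M, T k') (εE := h * β * L * (8 * h * L * M / n + 1)
      + (N₀ + 2 * N₁ + N₂) * (96 + 192 * L) * L ^ 2 / (h * (n : ℝ) ^ 2) * (K₁ : ℝ)⁻¹)
    hsplit hA hEpos (hEle.trans (add_le_add le_rfl hEerr)) rfl rfl hdeep hsmooth rfl hρV h3 h4 h5 h6
  -- match the statement
  have hlhs : (∑ k' ∈ Finset.Icc 1 M, T k')
      - B 0 * (Real.sqrt ℓ / Real.sqrt ℓ') *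
          (∑ k' ∈ Finset.Icc 1 K₀, (if ℓ ∣ n * ℓ' * k' then 1 / (k' : ℝ) else 0)) / n
      - h * β * (Real.sqrt ℓ' / Real.sqrt ℓ) * ((K₁ - K₀ : ℕ) : ℝ)
      - (ρ * (g / ℓ) * (B 0 * Real.log (2 * g) + IH - iB / 2) + β * ρ' / (4 * ℓ')) / n
      = (∑ k' ∈ Finset.Icc 1 M, T k')
      - B 0 * ρ * (∑ k' ∈ Finset.Icc 1 K₀, (if ℓ ∣ n * ℓ' * k' then 1 / (k' : ℝ) else 0)) / n
      - h * β * ρ' * ((K₁ - K₀ : ℕ) : ℝ)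
      - (ρ * (1 / P) * (B 0 * Real.log (2 * g) + IH - iB / 2) + β * ρ' / (4 * ℓ')) / n := by
    have hgP : g / (ℓ : ℝ) = 1 / P := by
      rw [eq_div_iff hP0.ne', div_mul_eq_mul_div, div_eq_iff hℓ0.ne', one_mul, mul_comm]; exact hPg
    rw [hgP, hρ, hρ']
  simp only [hT] at hlhs hmain
  rw [hlhs]
  exact hmain

/-- **Anchor `combTypeNodeMainRaw`** (registered sub-goal; `node_sharp_main_raw` with explicit quantifiers): the sharp node weight
of a main-range node, raw form. [folklore] -/
theorem combTypeNodeMainRaw : ∀ B B' B'' : ℝ → ℝ, ∀ N₀ N₁ N₂ h : ℝ, ∀ L ℓ ℓ' M n : ℕ, (∀ x, HasDerivAt B (B' x) x) → (∀ x, HasDerivAt B' (B'' x) x) → (∀ x, |B x| ≤ N₀) → (∀ x, |B' x| ≤ N₁) → (∀ x, |B'' x| ≤ N₂) → (∀ x, 2 < |x| → B x = 0) → (∀ x, 0 ≤ B x) → (1 ≤ L) → (1 ≤ ℓ) → (ℓ ≤ L) → (1 ≤ ℓ') → (ℓ' ≤ L) → (1 ≤ n) → (0 < h) → (h ≤ 1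 / (32 * L)) → (1 ≤ h * M) → (2 * (L : ℝ) ≤ h * M) → (8 * h * L ^ 2 * n ≤ 1) → |(∑ k' ∈ Finset.Icc 1 M, (∑ k ∈ Finset.Icc 1 M, B ((Real.log ((n : ℝ) * ℓ' * k' / ℓ) - Real.log k) / h) / Real.sqrt k) / Real.sqrt k' / Real.sqrt n) - B 0 * (Real.sqrt ℓ / Real.sqrt ℓ') * (∑ k' ∈ Finset.Icc 1 ⌊1 / (4 * h) / ((n : ℝ) * ℓ')⌋₊, (if ℓ ∣ n * ℓ' * k' then 1 / (k' : ℝ) else 0)) / n - h * (∫ v, B v * Real.exp (-(h * v) / 2)) * (Real.sqrt ℓ' / Real.sqrt ℓ) * ((min M ⌊(ℓ : ℝ) * M * Real.exp (-(2 * h)) / (ℓ' * n)⌋₊ - ⌊1 / (4 * h) / ((n : ℝ) * ℓ')⌋₊ : ℕ) : ℝ) - ((Real.sqrt ℓ / Real.sqrt ℓ') * ((Nat.gcd (n * ℓ') ℓ : ℝ) / ℓ) * (B 0 * Real.log (2 * (Nat.gcd (n * ℓ') ℓ : ℝ)) + (∫ v in Set.Ioi (1 / 2 : ℝ), ((∑'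 m : ℤ, B (m / v)) - v * ∫ x, B x) / v) - (∫ x, B x) / 2) + (∫ v, B v * Real.exp (-(h * v) / 2)) * (Real.sqrt ℓ' / Real.sqrt ℓ) / (4 * ℓ')) / n| ≤ ((192 * N₁ + 12 * N₀) * h * (Real.sqrt ℓ / Real.sqrt ℓ') * (16 * h * ℓ' * (min M ⌊(ℓ : ℝ) * M * Real.exp (-(2 * h)) / (ℓ' * n)⌋₊ : ℕ) / Nat.gcd (n * ℓ') ℓ + (∑ j ∈ Finset.Icc 1 (min M ⌊(ℓ : ℝ) * M * Real.exp (-(2 * h)) / (ℓ' * n)⌋₊), (1 : ℝ) / j) / n) + (16 * N₁ + 14 * N₀) * (Real.sqrt ℓ / Real.sqrt ℓ') * (ℓ' * h / Nat.gcd (n * ℓ') ℓ) * (2 * (1 + Real.log (⌈8 * (h * M) * L⌉₊ + 1)))) + (h * (∫ v, B v * Real.exp (-(h * v) / 2)) * L * (8 * h * L * M / n + 1) + (N₀ + 2 * N₁ + N₂) * (96 + 192 * L) * L ^ 2 / (h * (n : ℝ) ^ 2) * ((min M ⌊(ℓ : ℝ) * M * Real.exp (-(2 * h)) / (ℓ'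 * n)⌋₊ : ℕ) : ℝ)⁻¹) + B 0 * (Real.sqrt ℓ / Real.sqrt ℓ') / n * (2 / (min M ⌊(ℓ : ℝ) * M * Real.exp (-(2 * h)) / (ℓ' * n)⌋₊ : ℕ) + 2 / ⌊1 / (4 * h) / ((n : ℝ) * ℓ')⌋₊ + 8 * n * ℓ' * h / ((ℓ / Nat.gcd (n * ℓ') ℓ : ℕ) : ℝ)) + (Real.sqrt ℓ / Real.sqrt ℓ') / n * (1 / ((ℓ / Nat.gcd (n * ℓ') ℓ : ℕ) : ℝ)) * (5 * N₂ / (2 * ((min M ⌊(ℓ : ℝ) * M * Real.exp (-(2 * h)) / (ℓ' * n)⌋₊ : ℕ) * n * ℓ' * h / Nat.gcd (n * ℓ') ℓ))) + h * (8 * N₀ * h) * (Real.sqrt ℓ' / Real.sqrt ℓ) * (min M ⌊(ℓ : ℝ) * M * Real.exp (-(2 * h)) / (ℓ' * n)⌋₊ : ℕ) + (∫ v, B v * Real.exp (-(h * v) / 2)) * (Real.sqrt ℓ' / Real.sqrt ℓ) * h :=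
  fun _ _ _ _ _ _ _ _ _ _ _ _ hB hB' h0 h1 h2 hBs hB0 hL hℓ hℓL hℓ' hℓ'L hn hh hhL hhM hκL hnY =>
    node_sharp_main_raw hB hB' h0 h1 h2 hBs hB0 hL hℓ hℓL hℓ' hℓ'L hn hh hhL hhM hκL hnY

end CombType

end Summit.RiemannHypothesis.RiemannHypothesis.Theorems.SignConeConeMagnification

end
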